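import Mathlib

/-!
# `DegreeOnePrimesEscape`: the sign of the exceptional term on ESCAPE counts

Negative-side knowledge for crux `stmt-QuantumAdvantage-11543` (route LinnikCubicClassGroups),
extracted from the refuter work file
`Summits/QuantumAdvantage/QuantumAdvantage/Cruxes/DegreeOnePrimesEscape/Disproof.lean` (§10).

In the Thorner–Zaman dichotomy (tree fact `ThornerZaman2019_classPNT_hilbertClassField`) the
number of prime ideals of norm `≤ x` in the class `C` is `(Li(x) − χ₁(C)·Li(x^{β₁}))(1 + O(E))/h`
for one real class-group character `χ₁` with a real zero `β₁`. Summed over the classes OUTSIDE a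
subgroup `M` the exceptional term carries the coefficient `−∑_{C ∉ M} χ₁(C)`, and these lemmas
compute it exactly: `∑_{C ∉ M} χ(C) = h·[χ = 1] − |M|·[χ|_M = 1]`. Hence

* `re_sum_filter_not_mem_nonpos`: for `χ ≠ 1` the coefficient `−∑_{C∉M} χ(C)` is `≥ 0` — a
  NONTRIVIAL exceptional character can only ENRICH the escape set of the crux (by `|M|·Li(x^{β₁})/h`
  when `M ≤ ker χ₁`, by nothing otherwise);
* `sum_filter_not_mem_one`: for `χ = 1` it is `−(h − |M|) < 0` — the ONLY depletion of escape
  counts comes from a real zero of `ζ_K = L(s, 1)` itself, which is exactly what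
  `Stark1974_dedekindZeta_ne_zero_of_noQuadraticSubfield` (and the crux's hypothesis "no quadratic
  subfield") controls.

So any counterexample to the crux must be a number field without quadratic subfield whose own
Dedekind zeta function has a real zero extremely close to `1` — barred by Stark 1974. This
supersedes the `h/4` coset counting of `EscapeCounting.lean` for the exceptional-character case
(the favourable sign holds on ALL of `Cl ∖ M`, not only on `Cl ∖ (M ∪ K₁)`).
-/

open Finset

namespace Summit.QuantumAdvantage.QuantumAdvantage.Theorems.DegreeOnePrimesEscape.Negative

variable {G : Type*} [CommGroup G] [Fintype G]

/-- Orthogonality, trivial character: `∑_C 1 = |G|`. [folklore] -/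
theorem sum_univ_char_one : ∑ C : G, (((1 : G →* ℂˣ) C : ℂˣ) : ℂ) = Fintype.card G := by
  simp

/-- Orthogonality, nontrivial character: `∑_C χ(C) = 0` (Mathlib `sum_hom_units_eq_zero`).
[folklore] -/
theorem sum_univ_char_of_ne_one (χ : G →* ℂˣ) (hχ : χ ≠ 1) : ∑ C : G, ((χ C : ℂˣ) : ℂ) = 0 := by
  have hne : (Units.coeHom ℂ).comp χ ≠ 1 := by
    intro h1
    apply hχ
    ext g
    have := congrArg (fun f : G →* ℂ => f g) h1
    simpa using this
  simpa using sum_hom_units_eq_zero ((Units.coeHom ℂ).comp χ) hne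

/-- The sum of a character over a subgroup `M` is `|M|` if `χ|_M = 1`. [folklore] -/
theorem sum_filter_mem_of_restrict_eq_one (M : Subgroup G) [DecidablePred (· ∈ M)] (χ : G →* ℂˣ)
    (hχ : χ.comp M.subtype = 1) :
    ∑ C ∈ univ.filter (· ∈ M), ((χ C : ℂˣ) : ℂ) = (univ.filter (· ∈ M)).card := by
  rw [Finset.card_eq_sum_ones, Nat.cast_sum]
  refine Finset.sum_congr rfl fun C hC => ?_
  simp only [mem_filter, mem_univ, true_and] at hC
  have := congrArg (fun f : M →* ℂˣ => f ⟨C, hC⟩) hχ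
  simp only [MonoidHom.coe_comp, Subgroup.coe_subtype, Function.comp_apply, MonoidHom.one_apply]
    at this
  simp [this]

/-- The sum of a character over a subgroup `M` is `0` if `χ|_M ≠ 1`. [folklore] -/
theorem sum_filter_mem_of_restrict_ne_one (M : Subgroup G) [DecidablePred (· ∈ M)] (χ : G →* ℂˣ)
    (hχ : χ.comp M.subtype ≠ 1) :
    ∑ C ∈ univ.filter (· ∈ M), ((χ C : ℂˣ) : ℂ) = 0 := by
  rw [Finset.sum_subtype (univ.filter (· ∈ M)) (p := (· ∈ M)) (by simp)
    (f := fun C : G => ((χ C : ℂˣ) : ℂ))]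
  have h := sum_univ_char_of_ne_one (G := M) (χ.comp M.subtype) hχ
  simpa using h

/-- The real part of the sum of a character over a subgroup is `≥ 0` (it is `|M|` or `0`).
[folklore] -/
theorem re_sum_filter_mem_nonneg (M : Subgroup G) [DecidablePred (· ∈ M)] (χ : G →* ℂˣ) :
    0 ≤ (∑ C ∈ univ.filter (· ∈ M), ((χ C : ℂˣ) : ℂ)).re := by
  by_cases hχ : χ.comp M.subtype = 1
  · rw [sum_filter_mem_of_restrict_eq_one M χ hχ]; simp
  · rw [sum_filter_mem_of_restrict_ne_one M χ hχ]; simp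

/-- Complement = total − subgroup. [folklore] -/
theorem sum_filter_not_mem_eq (M : Subgroup G) [DecidablePred (· ∈ M)] (χ : G →* ℂˣ) :
    ∑ C ∈ univ.filter (· ∉ M), ((χ C : ℂˣ) : ℂ) =
      ∑ C : G, ((χ C : ℂˣ) : ℂ) - ∑ C ∈ univ.filter (· ∈ M), ((χ C : ℂˣ) : ℂ) := by
  rw [← Finset.sum_filter_add_sum_filter_not univ (· ∈ M) (fun C : G => ((χ C : ℂˣ) : ℂ))]
  ring

/-- **A nontrivial character sums to a non-positive real over the complement of a subgroup**
(`∑_{C∉M} χ(C) = −|M|·[χ|_M = 1] ≤ 0` for `χ ≠ 1`): in the Thorner–Zaman main term the exceptional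
contribution to the ESCAPE count `∑_{C∉M} π_C(x)` is `−(∑_{C∉M} χ₁(C))·Li(x^{β₁})/h ≥ 0` — a
nontrivial exceptional character never depletes the escape set. [folklore] -/
theorem re_sum_filter_not_mem_nonpos (M : Subgroup G) [DecidablePred (· ∈ M)] (χ : G →* ℂˣ)
    (hχ : χ ≠ 1) : (∑ C ∈ univ.filter (· ∉ M), ((χ C : ℂˣ) : ℂ)).re ≤ 0 := by
  rw [sum_filter_not_mem_eq, sum_univ_char_of_ne_one χ hχ, zero_sub, Complex.neg_re, neg_nonpos]
  exact re_sum_filter_mem_nonneg M χ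

/-- Exact value for `χ ≠ 1`, `χ|_M = 1` (i.e. `M ≤ ker χ`): `∑_{C∉M} χ(C) = −|M|` — the escape set
is ENRICHED by `|M|·Li(x^{β₁})/h`. [folklore] -/
theorem sum_filter_not_mem_of_restrict_eq_one (M : Subgroup G) [DecidablePred (· ∈ M)]
    (χ : G →* ℂˣ) (hχ : χ ≠ 1) (hM : χ.comp M.subtype = 1) :
    ∑ C ∈ univ.filter (· ∉ M), ((χ C : ℂˣ) : ℂ) = -((univ.filter (· ∈ M)).card : ℂ) := by
  rw [sum_filter_not_mem_eq, sum_univ_char_of_ne_one χ hχ, sum_filter_mem_of_restrict_eq_one M χ hM,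
    zero_sub]

/-- Exact value for `χ|_M ≠ 1`: `∑_{C∉M} χ(C) = 0` — no exceptional effect on the escape count at
all. [folklore] -/
theorem sum_filter_not_mem_of_restrict_ne_one (M : Subgroup G) [DecidablePred (· ∈ M)]
    (χ : G →* ℂˣ) (hM : χ.comp M.subtype ≠ 1) :
    ∑ C ∈ univ.filter (· ∉ M), ((χ C : ℂˣ) : ℂ) = 0 := by
  have hχ : χ ≠ 1 := by
    rintro rfl
    exact hM (by ext; simp)
  rw [sum_filter_not_mem_eq, sum_univ_char_of_ne_one χ hχ, sum_filter_mem_of_restrict_ne_one M χ hM,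
    sub_zero]

/-- **The depleting case is the trivial character**: `∑_{C∉M} 1 = |G ∖ M| = h − |M| > 0` for `M`
proper, so the exceptional term `−(h − |M|)·Li(x^{β₁})/h` of a real zero `β₁` of `ζ_K = L(s,1)`
DEPLETES every escape count — the one enemy of the crux, barred by Stark 1974 for fields without
quadratic subfield. [folklore] -/
theorem sum_filter_not_mem_one (M : Subgroup G) [DecidablePred (· ∈ M)] :
    ∑ C ∈ univ.filter (· ∉ M), (((1 : G →* ℂˣ) C : ℂˣ) : ℂ) = (univ.filter (· ∉ M)).card := by
  simp

/-- … and that count is positive exactly when `M` is proper. [folklore] -/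
theorem card_filter_not_mem_pos (M : Subgroup G) [DecidablePred (· ∈ M)] (hM : M ≠ ⊤) :
    0 < (univ.filter fun C : G => C ∉ M).card := by
  rw [Finset.card_pos]
  obtain ⟨g, hg⟩ : ∃ g : G, g ∉ M := by
    simpa [Subgroup.eq_top_iff', not_forall] using hM
  exact ⟨g, by simpa using hg⟩

/-- **Signed escape mass (supersedes the `h/4` coset bound of `EscapeCounting.lean` in the
nontrivial-exceptional-character case).** If the classwise counts obey a Thorner–Zaman-shaped lower
bound `f C ≥ a − Re χ(C) · b` with a NONTRIVIAL character `χ` and an exceptional magnitude `b ≥ 0`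
(on paper `a = (1 − E)Li(x)/h`, `b = (1 + E)Li(x^{β₁})/h`), then the classes outside ANY subgroup
`M` carry at least `a · |Cl ∖ M|` in total: the exceptional term drops out with the right sign.
[folklore] -/
theorem escape_mass_signed (M : Subgroup G) [DecidablePred (· ∈ M)] (χ : G →* ℂˣ) (hχ : χ ≠ 1)
    (f : G → ℝ) (a b : ℝ) (hb : 0 ≤ b) (hf : ∀ C : G, a - ((χ C : ℂˣ) : ℂ).re * b ≤ f C) :
    ((univ.filter fun C : G => C ∉ M).card : ℝ) * a ≤ ∑ C ∈ univ.filter (· ∉ M), f C := by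
  have h1 : ∑ C ∈ univ.filter (· ∉ M), (a - ((χ C : ℂˣ) : ℂ).re * b) ≤
      ∑ C ∈ univ.filter (· ∉ M), f C := Finset.sum_le_sum fun C _ => hf C
  have h2 : ∑ C ∈ univ.filter (· ∉ M), (a - ((χ C : ℂˣ) : ℂ).re * b) =
      ((univ.filter fun C : G => C ∉ M).card : ℝ) * a -
        (∑ C ∈ univ.filter (· ∉ M), ((χ C : ℂˣ) : ℂ)).re * b := by
    rw [Finset.sum_sub_distrib, Finset.sum_const, nsmul_eq_mul, Complex.re_sum, Finset.sum_mul]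
  have h3 : (∑ C ∈ univ.filter (· ∉ M), ((χ C : ℂˣ) : ℂ)).re * b ≤ 0 :=
    mul_nonpos_of_nonpos_of_nonneg (re_sum_filter_not_mem_nonpos M χ hχ) hb
  linarith

/-- … hence, for `M` proper, at least `a · h/2` (a proper subgroup misses at least half of the
group): the nontrivial-exceptional case of the crux is as good as the unexceptional one.
[folklore] -/
theorem escape_mass_half_signed (M : Subgroup G) [DecidablePred (· ∈ M)] (hM : M ≠ ⊤)
    (χ : G →* ℂˣ) (hχ : χ ≠ 1) (f : G → ℝ) (a b : ℝ) (ha : 0 ≤ a) (hb : 0 ≤ b)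
    (hf : ∀ C : G, a - ((χ C : ℂˣ) : ℂ).re * b ≤ f C) :
    (Fintype.card G : ℝ) * a ≤ 2 * ∑ C ∈ univ.filter (· ∉ M), f C := by
  have hsigned := escape_mass_signed M χ hχ f a b hb hf
  -- `|G| ≤ 2 · |G ∖ M|` for a proper subgroup
  have hidx : 2 ≤ M.index := Subgroup.one_lt_index_of_ne_top hM
  have hMc : Nat.card M * M.index = Nat.card G := M.card_mul_index
  have hcardM : (univ.filter fun C : G => C ∈ M).card = Nat.card M := by
    rw [Nat.card_eq_fintype_card, Fintype.card_subtype]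
  have hsplit : (univ.filter fun C : G => C ∈ M).card + (univ.filter fun C : G => C ∉ M).card =
      Fintype.card G := Finset.card_filter_add_card_filter_not _
  have hG : Nat.card G = Fintype.card G := Nat.card_eq_fintype_card
  have hnat : Fintype.card G ≤ 2 * (univ.filter fun C : G => C ∉ M).card := by
    have h2M : 2 * Nat.card M ≤ Nat.card G := by
      calc 2 * Nat.card M ≤ M.index * Nat.card M := Nat.mul_le_mul_right _ hidx
        _ = Nat.card G := by rw [mul_comm]; exact hMc
    omega
  have hreal : (Fintype.card G : ℝ) ≤ 2 * ((univ.filter fun C : G => C ∉ M).card : ℝ) := by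
    exact_mod_cast hnat
  nlinarith

end Summit.QuantumAdvantage.QuantumAdvantage.Theorems.DegreeOnePrimesEscape.Negative
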